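import Summits.QuantumFields.YangMills.Theorems.ParabolicTrajectoryTunedSequenceExistsQFemtoReduction

/-!
# `ClosesQ` — pre-verification for the planner (lead c5): restating (A), (B), (S) of route ParabolicTrajectory on the
# time-zero plaquette `Q = plaquetteObs r.ρ 0 1 2` keeps the deciding theorem `closes` valid VERBATIM.

The three bodies below are the rev-7 bodies of `ContinuumLimitOnTrajectory`, `LatticeGapOnTrajectory`, `TunedSequenceExists` with
every `latticeConnectedCorr r.ρ (sch.β k) (sch.side k) r.curvature.F r.curvature.F (…)` replaced by
`latticeConnectedCorr r.ρ (sch.β k) (sch.side k) (plaquetteObs r.ρ 0 1 2) (plaquetteObs r.ρ 0 1 2) (…)` (Literature-level vocabulary only,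
so a Theses file can state them); `TunedSequenceExistsQ'` is definitionally `RPDiagonalVariant.TunedSequenceExistsQ` (whose `spatialPlaquette r`
unfolds to `plaquetteObs r.ρ 0 1 2`).  `closesQ` is the rev-7 `closes` proof, unchanged.  Workfile only (planners own Theses); rc 0 expected.
-/

namespace Summit.QuantumFields.YangMills.Cruxes.TunedSequenceExists.ClosesQ

open scoped BigOperators Topology
open Filter Set Function TopologicalSpace MeasureTheory
open Literature.MathematicalPhysics.QuantumLattice (plaquetteObs)

/-- (A_Q): `ContinuumLimitOnTrajectory` with the tuning pin `Q`. -/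
def ContinuumLimitOnTrajectoryQ : Prop :=
  ∀ (G : Type) [Group G] [TopologicalSpace G] [IsTopologicalGroup G] [CompactSpace G], Literature.MathematicalPhysics.QuantumFieldTheory.IsCompactSimpleLieGroup G → letI : MeasurableSpace G := borel G; haveI : BorelSpace G := ⟨rfl⟩; ∀ (r : Literature.MathematicalPhysics.QuantumFieldTheory.LatticeRep G), ∃ M₀ : ℕ, ∀ M : ℕ, M₀ ≤ M → 2 ≤ M → ∃ θ₀ : ℝ, 0 < θ₀ ∧ ∀ (θ Δ : ℝ) (sch : Literature.MathematicalPhysics.QuantumFieldTheory.SpeciesScheme (Literature.MathematicalPhysics.QuantumFieldTheory.YMSpecies G)) (n : ℕ → ℕ), 0 < θ → θ < θ₀ → 0 < Δ → (∀ k, sch.a k = ((M : ℝ) ^ n k)⁻¹) → Filter.Tendsto sch.β Filter.atTop Filter.atTop → (∀ t : ℕ, 0 < t → ∃ c : ℝ, Filter.Tendsto (fun k => ((M : ℝ) ^ n k) ^ 8 * Literature.MathematicalPhysics.QuantumFieldTheory.latticeConnectedCorr r.ρ (sch.β k) (sch.side k) (plaquetteObs r.ρ 0 1 2) (plaquetteObs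 r.ρ 0 1 2) (t * M ^ n k)) Filter.atTop (nhds c)) → Filter.Tendsto (fun k => ((M : ℝ) ^ n k) ^ 8 * Literature.MathematicalPhysics.QuantumFieldTheory.latticeConnectedCorr r.ρ (sch.β k) (sch.side k) (plaquetteObs r.ρ 0 1 2) (plaquetteObs r.ρ 0 1 2) (M ^ n k)) Filter.atTop (nhds θ) → Literature.MathematicalPhysics.QuantumFieldTheory.HasLatticeMassGap r sch Δ → ∃ sch' : Literature.MathematicalPhysics.QuantumFieldTheory.SpeciesScheme (Literature.MathematicalPhysics.QuantumFieldTheory.YMSpecies G), sch'.a = sch.a ∧ sch'.β = sch.β ∧ sch'.L = sch.L ∧ ∃ T : Literature.MathematicalPhysics.QuantumFieldTheory.OSData (Literature.MathematicalPhysics.QuantumFieldTheory.YMSpecies G) 4, Literature.MathematicalPhysics.QuantumFieldTheory.IsYangMillsFor r sch' T ∧ T.IsNontrivial r.curvature ∧ T.IsNonGaussian r.curvature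

/-- (B_Q): `LatticeGapOnTrajectory` with the tuning pin `Q`. -/
def LatticeGapOnTrajectoryQ : Prop :=
  ∀ (G : Type) [Group G] [TopologicalSpace G] [IsTopologicalGroup G] [CompactSpace G], Literature.MathematicalPhysics.QuantumFieldTheory.IsCompactSimpleLieGroup G → letI : MeasurableSpace G := borel G; haveI : BorelSpace G := ⟨rfl⟩; ∀ (r : Literature.MathematicalPhysics.QuantumFieldTheory.LatticeRep G) (M : ℕ) (θ : ℝ) (sch : Literature.MathematicalPhysics.QuantumFieldTheory.SpeciesScheme (Literature.MathematicalPhysics.QuantumFieldTheory.YMSpecies G)) (n : ℕ → ℕ), 2 ≤ M → 0 < θ → (∀ k, sch.a k = ((M : ℝ) ^ n k)⁻¹) → Filter.Tendsto sch.β Filter.atTop Filter.atTop → Filter.Tendsto (fun k => ((M : ℝ) ^ n k) ^ 8 * Literature.MathematicalPhysics.QuantumFieldTheory.latticeConnectedCorr r.ρ (sch.β k) (sch.side k) (plaquetteObs r.ρ 0 1 2) (plaquetteObs r.ρ 0 1 2) (M ^ n k)) Filter.atTop (nhds θ) → ∃ Δ : ℝ, 0 < Δ ∧ Literature.MathematicalPhysics.QuantumFieldTheory.HasLatticeMassGap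 r sch Δ ∧ ∀ sch' : Literature.MathematicalPhysics.QuantumFieldTheory.SpeciesScheme (Literature.MathematicalPhysics.QuantumFieldTheory.YMSpecies G), sch'.a = sch.a → sch'.β = sch.β → sch'.L = sch.L → ∀ T : Literature.MathematicalPhysics.QuantumFieldTheory.OSData (Literature.MathematicalPhysics.QuantumFieldTheory.YMSpecies G) 4, Literature.MathematicalPhysics.QuantumFieldTheory.IsYangMillsFor r sch' T → T.HasMassGap Δ

/-- (S_Q): `TunedSequenceExists` with the tuning pin `Q` (= `RPDiagonalVariant.TunedSequenceExistsQ` up to unfolding `spatialPlaquette`). -/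
def TunedSequenceExistsQ' : Prop :=
  ∀ (G : Type) [Group G] [TopologicalSpace G] [IsTopologicalGroup G] [CompactSpace G], Literature.MathematicalPhysics.QuantumFieldTheory.IsCompactSimpleLieGroup G → letI : MeasurableSpace G := borel G; haveI : BorelSpace G := ⟨rfl⟩; ∀ (r : Literature.MathematicalPhysics.QuantumFieldTheory.LatticeRep G) (M : ℕ), 2 ≤ M → ∃ θ₀ : ℝ, 0 < θ₀ ∧ ∀ θ : ℝ, 0 < θ → θ < θ₀ → ∃ (sch : Literature.MathematicalPhysics.QuantumFieldTheory.SpeciesScheme (Literature.MathematicalPhysics.QuantumFieldTheory.YMSpecies G)) (n : ℕ → ℕ), (∀ k, sch.a k = ((M : ℝ) ^ n k)⁻¹) ∧ Filter.Tendsto sch.β Filter.atTop Filter.atTop ∧ (∀ t : ℕ, 0 < t → ∃ c : ℝ, Filter.Tendsto (fun k => ((M : ℝ) ^ n k) ^ 8 * Literature.MathematicalPhysics.QuantumFieldTheory.latticeConnectedCorr r.ρ (sch.β k) (sch.side k) (plaquetteObs r.ρ 0 1 2) (plaquetteObs r.ρ 0 1 2) (t * M ^ n k)) Filter.atTop (nhds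 c)) ∧ Filter.Tendsto (fun k => ((M : ℝ) ^ n k) ^ 8 * Literature.MathematicalPhysics.QuantumFieldTheory.latticeConnectedCorr r.ρ (sch.β k) (sch.side k) (plaquetteObs r.ρ 0 1 2) (plaquetteObs r.ρ 0 1 2) (M ^ n k)) Filter.atTop (nhds θ)

/-- The rev-7 `closes` proof, verbatim, for the `Q`-restated items. -/
theorem closesQ : ContinuumLimitOnTrajectoryQ → LatticeGapOnTrajectoryQ → TunedSequenceExistsQ' → YangMills := by
  intro hA hB hS G _ _ _ _ hG
  obtain ⟨r⟩ := hG.2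
  letI : MeasurableSpace G := borel G
  haveI : BorelSpace G := ⟨rfl⟩
  obtain ⟨M₀, hM₀⟩ := hA G hG r
  have hM2 : 2 ≤ max M₀ 2 := le_max_right _ _
  obtain ⟨θ₀, hθ₀, hA'⟩ := hM₀ (max M₀ 2) (le_max_left _ _) hM2
  obtain ⟨θ₁, hθ₁, hS'⟩ := hS G hG r (max M₀ 2) hM2
  have hθpos : 0 < min θ₀ θ₁ / 2 := by positivity
  have hθlt₀ : min θ₀ θ₁ / 2 < θ₀ := by have := min_le_left θ₀ θ₁; linarith
  have hθlt₁ : min θ₀ θ₁ / 2 < θ₁ := by have := min_le_right θ₀ θ₁; linarith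
  obtain ⟨sch, n, hshape, hbeta, hconv, htune⟩ := hS' (min θ₀ θ₁ / 2) hθpos hθlt₁
  obtain ⟨Δ, hΔ, hgap, htransfer⟩ :=
    hB G hG r (max M₀ 2) (min θ₀ θ₁ / 2) sch n hM2 hθpos hshape hbeta htune
  obtain ⟨sch', ha, hβ, hL, T, hYM, hNT, hNG⟩ :=
    hA' (min θ₀ θ₁ / 2) Δ sch n hθpos hθlt₀ hΔ hshape hbeta hconv htune hgap
  have hweak : sch'.HasWeakCouplingLimit := by
    show Filter.Tendsto sch'.β Filter.atTop Filter.atTop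
    rw [hβ]
    exact hbeta
  refine ⟨r, sch', T, hweak, hYM, hNT, hNG, Δ, hΔ, htransfer sch' ha hβ hL T hYM, ?_⟩
  intro A B
  obtain ⟨C, hC⟩ := hgap A B
  refine ⟨C, ?_⟩
  simpa only [ha, hβ, hL] using hC

/-- `(S_Q)` as written here IS the landed `RPDiagonalVariant.TunedSequenceExistsQ` (definitional). -/
example : TunedSequenceExistsQ' ↔
    Summit.QuantumFields.YangMills.Theorems.TunedSequenceExists.RPDiagonalVariant.TunedSequenceExistsQ :=
  Iff.rfl

/-- Hence the landed one-new-child reduction feeds `closesQ`'s third hypothesis directly: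
granted (A_Q), (B_Q), the sibling crux and (V_Q,rel), `YangMills` follows. -/
example (hA : ContinuumLimitOnTrajectoryQ) (hB : LatticeGapOnTrajectoryQ)
    (hF : Summit.QuantumFields.YangMills.Theses.LangevinControlUV.FemtoCurvatureTwoPointC)
    (hV : Summit.QuantumFields.YangMills.Theorems.TunedSequenceExists.QFemto.VolumeMonotoneQRelAll) : YangMills :=
  closesQ hA hB
    (Summit.QuantumFields.YangMills.Theorems.TunedSequenceExists.QFemto.tunedSequenceExistsQ_of_femtoC_of_volumeRel hF hV)

end Summit.QuantumFields.YangMills.Cruxes.TunedSequenceExists.ClosesQ
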